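import Summits.QuantumFields.BalabanUV.Beta.WardLocusCombShift
import Summits.QuantumFields.BalabanUV.Beta.CombChartWardSockets

/-!
# `BalabanUV.Beta.WardLocusCombSockets` — binder row D1, RULING R-D1-g35-1 (chart (III′)), brick P4c-W-ii: **THE (Sd) LAW OF THE PURE TABLES AND THE FIRST-ORDER
# WARD LAW (hD) OF THE UNFOLDED VERTEX `dM (GcombSh Lc j) Lc (SpureCombOf … j) (tabs.M j)`** — the (III′) twin of `WardLocusSymSockets` §2–§3 at the comb-chart
# resolvent `G′_j` and an1's typed shift: the pure tables' (Sd) law against `bhKStepSh d Lc (Dsh Lc) j` (from `WardLocusCombShift` through the slot-generic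
# `divV_SpureRecOf_eq_divV_SrecOf`), and an1's `KernelWardMColumn.divV_dM_eq_conjV` fed with `colM_GcombSh_ward`, `colH_ward_GcombSh` and that law

HONEST FRAMING (cell contract, verbatim): «discharging `BetaPertH` makes Bałaban's UV stability UNCONDITIONAL — a real constructive-QFT
result; it is NOT the continuum limit and NOT the Clay problem.»  HONEST DEPENDENCY: continuum YM on T⁴ ⇐ BetaPertH ∧ nine spine estimates (0/9 proved);
BetaPertH ⇐ (D1) ∧ (D4) ∧ CAP+tail; G-an2-4 gates asym, D1 and NE2/3/4.
DERIVED cell leaf ([folklore] wiring BY NAME; β sub-cell, BINDER-OWNERS row D1 OWNER `b2b-balaban-beta-an2` gen 36).  No statement of Bałaban's papers, no `[cite:]`,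
no `Prop` fact, no `def`.  WHAT: §1 **`hSd_SpureRecOf_GcombSh_bhKStepSh_all_pins`**, `hSd_SpureCombOf_all`; §2 **`divV_dM_SpureCombOf_eq_conjV`**:
`divV (dM (GcombSh Lc j) Lc (SpureCombOf tabs Lc^{d+1} (−Lc^{d+1}·½·Lc^{d+1}) cΛ j) (tabs.M j)) y = conjV (bhKStepSh d Lc (Dsh Lc) j) (diagK (½ • Σ_v legInd ρ_c (Lc•y+v)))`
under the border letter (V-d) alone — the `hD` input of the slot-generic second-order Ward chain (`WardLocusRecursiveLettersSlot.exists_kernelLaws_of_letters_slot`) at `G := GcombSh`.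
Discharges NO binder of the row by itself; NOT D1, NOT `BetaPertH`, NOT continuum, NOT Clay.
Provenance: β sub-cell, unit beta-an2 gen 36, 2026-08-22 (v1); over `WardLocusCombShift`, `CombChartWardSockets`, `CombChartHColumnWard` (this gen), `WardLocusSymSockets` §2,
`KernelWardMColumn`, `CombChartStepJets` (P3) BY NAME; no existing file touched.
-/

noncomputable section

open Finset
open scoped BigOperators
open Literature.MathematicalPhysics.QuantumFieldTheory
open Literature.MathematicalPhysics.QuantumFieldTheory.Balaban1983to89
open Literature.MathematicalPhysics.QuantumFieldTheory.Balaban1983to89.Beta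
open ExpKernelCalculus (MKer Decays BiLoc VertexFamily comp)
open KernelWard (divV bdd_of_biLoc)
open AffineAveraging (Site box toSite)
open AveragingContoursRooted (ctr ctrOff ctrOff_mem_box)
open OneStepResolventKernel (Fib LocStencil)
open OneStepKernelFamily (KInvStep)
open SecondOrderResponse (colM dM)
open Summit.QuantumFields.BalabanUV.Beta.TameKernelCalculus
open Summit.QuantumFields.BalabanUV.Beta.ChartConjugation (conjV)
open Summit.QuantumFields.BalabanUV.Beta.AxialDressingRooted (one_le_of_neZero)
open Summit.QuantumFields.BalabanUV.Beta.BorderedHessian (bhK stepScale diagK)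
open Summit.QuantumFields.BalabanUV.Beta.AveragingWardRootedStencils (legInd)
open Summit.QuantumFields.BalabanUV.Beta.WardLocusStencils (ffK)
open Summit.QuantumFields.BalabanUV.Beta.SpineRooted (SpureRecOf)
open Summit.QuantumFields.BalabanUV.Beta.KernelWardMColumn (divV_dM_eq_conjV)
open Summit.QuantumFields.BalabanUV.Beta.SymmetrisedStepJets (SymTables)
open Summit.QuantumFields.BalabanUV.Beta.SymShiftedSpread (bhKStepSh)
open Summit.QuantumFields.BalabanUV.Beta.DshAn1 (Dsh)
open Summit.QuantumFields.BalabanUV.Beta.WardLocusSymSockets (divV_SpureRecOf_eq_divV_SrecOf)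
open Summit.QuantumFields.BalabanUV.Beta.CombChartStepJets (GcombSh decays_GcombSh SpureCombOf SpureCombOf_eq locStencil_SpureCombOf)
open Summit.QuantumFields.BalabanUV.Beta.CombChartHColumnWard (colH_ward_GcombSh)
open Summit.QuantumFields.BalabanUV.Beta.CombChartWardSockets (colM_GcombSh_ward)
open Summit.QuantumFields.BalabanUV.Beta.WardLocusCombShift (hSd_SrecOf_GcombSh_bhKStepSh_all_pins)

namespace Summit.QuantumFields.BalabanUV.Beta.WardLocusCombSockets

variable {d : ℕ} {Lc : ℕ} [NeZero Lc]

/-! ## §1 (Sd) for the pure tables at the comb-chart resolvents -/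

section Pure

variable {V H : Fin (d + 1) → (Fin (d + 1) → ℤ) → MKer (d + 1) (Fib d)}

/-- [folklore] **(Sd) FOR THE PURE TABLES `SpureRecOf V H (GcombSh Lc)` AT THE PINS AGAINST `bhKStepSh d Lc (Dsh Lc) j`**, every level:
`WardLocusCombShift.hSd_SrecOf_GcombSh_bhKStepSh_all_pins` read through the slot-generic `divV_SpureRecOf_eq_divV_SrecOf` — under (LV)(LH) and the border letter (V-d). -/
theorem hSd_SpureRecOf_GcombSh_bhKStepSh_all_pins (hV : ∀ δ : ℝ, 0 ≤ δ → ∃ C : ℝ, LocStencil V C δ)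
    (hH : ∀ δ : ℝ, 0 ≤ δ → ∃ C : ℝ, VertexFamily H Lc C δ)
    (hVd : ∀ u : Fin (d + 1) → ℤ, conjV (bhK Lc + Dsh Lc) (diagK (legInd (ctr (d + 1) Lc) u)) =
      conjV (ffK (bhK (d := d) Lc)) (diagK (legInd (ctr (d + 1) Lc) u)) - ((Lc : ℝ) ^ (d + 1)) • divV V u)
    (cΛ : ℝ) (j : ℕ) (y : Fin (d + 1) → ℤ) :
    (stepScale d Lc j * (Lc : ℝ) ^ (d + 1))⁻¹ • ∑ v ∈ box (d + 1) Lc,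
        divV (SpureRecOf d Lc V H (GcombSh Lc) ((Lc : ℝ) ^ (d + 1)) (-((Lc : ℝ) ^ (d + 1) * (1 / 2) * (Lc : ℝ) ^ (d + 1))) cΛ j) ((Lc : ℤ) • y + toSite v) =
      conjV (bhKStepSh d Lc (Dsh Lc) j) (diagK ((1 / 2 : ℝ) • ∑ v ∈ box (d + 1) Lc, legInd (ctr (d + 1) Lc) ((Lc : ℤ) • y + toSite v))) := by
  simp only [divV_SpureRecOf_eq_divV_SrecOf hH]
  exact hSd_SrecOf_GcombSh_bhKStepSh_all_pins hV hH hVd cΛ j y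

/-- [folklore] **(Sd) FOR THE (III′) LITERAL's PURE TABLES `SpureCombOf tabs`** at the pins against `bhKStepSh d Lc (Dsh Lc) j`, every level, under (V-d). -/
theorem hSd_SpureCombOf_all (tabs : SymTables d Lc)
    (hVd : ∀ u : Fin (d + 1) → ℤ, conjV (bhK Lc + Dsh Lc) (diagK (legInd (ctr (d + 1) Lc) u)) =
      conjV (ffK (bhK (d := d) Lc)) (diagK (legInd (ctr (d + 1) Lc) u)) - ((Lc : ℝ) ^ (d + 1)) • divV tabs.V u)
    (cΛ : ℝ) (j : ℕ) (y : Fin (d + 1) → ℤ) :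
    (stepScale d Lc j * (Lc : ℝ) ^ (d + 1))⁻¹ • ∑ v ∈ box (d + 1) Lc,
        divV (SpureCombOf tabs ((Lc : ℝ) ^ (d + 1)) (-((Lc : ℝ) ^ (d + 1) * (1 / 2) * (Lc : ℝ) ^ (d + 1))) cΛ j) ((Lc : ℤ) • y + toSite v) =
      conjV (bhKStepSh d Lc (Dsh Lc) j) (diagK ((1 / 2 : ℝ) • ∑ v ∈ box (d + 1) Lc, legInd (ctr (d + 1) Lc) ((Lc : ℤ) • y + toSite v))) := by
  rw [SpureCombOf_eq]
  exact hSd_SpureRecOf_GcombSh_bhKStepSh_all_pins tabs.hV tabs.hH hVd cΛ j y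

end Pure

/-! ## §2 (hD): the first-order Ward law of the unfolded vertex through `G′_j` -/

/-- [folklore] **(hD) FOR THE CHART-(III′) LITERAL, EVERY LEVEL** (generic `d`, the pins of record): under the border letter (V-d) against `bhK Lc + Dsh Lc`,
`divV (dM (GcombSh Lc j) Lc (SpureCombOf tabs … j) (tabs.M j)) y = conjV (bhKStepSh d Lc (Dsh Lc) j) (diagK (½ • Σ_v legInd ρ_c (Lc•y+v)))` —
an1's `divV_dM_eq_conjV` fed with (hMw) `colM_GcombSh_ward`, (hH) `colH_ward_GcombSh`, §1's (Sd) law of the pure tables and (LM). -/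
theorem divV_dM_SpureCombOf_eq_conjV (tabs : SymTables d Lc)
    (hVd : ∀ u : Fin (d + 1) → ℤ, conjV (bhK Lc + Dsh Lc) (diagK (legInd (ctr (d + 1) Lc) u)) =
      conjV (ffK (bhK (d := d) Lc)) (diagK (legInd (ctr (d + 1) Lc) u)) - ((Lc : ℝ) ^ (d + 1)) • divV tabs.V u)
    (cΛ : ℝ) (j : ℕ) (y : Fin (d + 1) → ℤ) :
    divV (dM (GcombSh Lc j) Lc (SpureCombOf tabs ((Lc : ℝ) ^ (d + 1)) (-((Lc : ℝ) ^ (d + 1) * (1 / 2) * (Lc : ℝ) ^ (d + 1))) cΛ j) (tabs.M j)) y =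
      conjV (bhKStepSh d Lc (Dsh Lc) j) (diagK ((1 / 2 : ℝ) • ∑ v ∈ box (d + 1) Lc, legInd (ctr (d + 1) Lc) ((Lc : ℤ) • y + toSite v))) := by
  have hLc : 1 ≤ Lc := one_le_of_neZero Lc
  obtain ⟨Cs, δs, hδs, hS⟩ := locStencil_SpureCombOf tabs ((Lc : ℝ) ^ (d + 1)) (-((Lc : ℝ) ^ (d + 1) * (1 / 2) * (Lc : ℝ) ^ (d + 1))) cΛ j
  obtain ⟨CM, δM, hδM, hM⟩ := tabs.hM j
  have hMb : ∀ ρ w x z a b, |tabs.M j ρ w x z a b| ≤ CM := fun ρ w x z a b => bdd_of_biLoc (hM ρ w) hδM.le x z a b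
  exact divV_dM_eq_conjV (decays_GcombSh Lc j) hLc (fun y ρ w => colM_GcombSh_ward (d := d) (Lc := Lc) j y ρ w) hS hδs
    ((stepScale d Lc j * (Lc : ℝ) ^ (d + 1))⁻¹) (fun y κ' u => colH_ward_GcombSh (d := d) (Lc := Lc) j y κ' u)
    (fun y => hSd_SpureCombOf_all tabs hVd cΛ j y) hMb y

end Summit.QuantumFields.BalabanUV.Beta.WardLocusCombSockets

end
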